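import Summits.ResolutionOfSingularities.ResolutionOfSingularities.Theorems.FrobeniusLadderFRationalResolutionEtaleChartPrimaryCentre
import HarnessLib

/-!
# Crux `FrobeniusLadder.FRationalResolution` (stmt-ResolutionOfSingularities-15317), line `redirect`,
# stub `stub_diagonalizableQuotientResolution` — brick E-k AT ONE ISOLATED SINGULAR POINT, without global finiteness of
# the singular locus (so that the isolated-point lane feeds `…SingBlowupOffFinset` / `…SingBlowupAtlasOffFinset`, where
# the other singular points form positive-dimensional rank-2 strata)

`…EtaleChartPrimaryCentre.hloc_of_etale_chart_primaryBlowup` produces the local resolution datum `hloc` at a singular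
point `x = φ y` (étale chart `φ : Y → X` with trivial residue extension at `y`, an affine open `V ∋ y` with a
`𝔮_y`-primary ideal `J` whose blow-up is regular) under the GLOBAL hypothesis «`Sing X` finite», used only to put `x`
inside an open containing no other singular point and to know that `x` is closed. Here both are taken as LOCAL
hypotheses at `x` (`hiso`, `hxcl`); the proof is otherwise that of the global version verbatim (shrink `V` to a basic
open inside `φ⁻¹ U` for an affine `U ∋ x` inside the isolating open; `…PrimaryCentreEtale.hloc_of_primaryBlowup_flat_chart`).

* **`hloc_of_etale_chart_primaryBlowup_of_isolated`** — the datum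
  `∃ W ∋ x, (W ∩ Sing X = {x}) ∧ ∃ ρ : Z → W proper, Z regular, iso over W ∩ Reg X with dense preimage`,
  exactly the `hloc` consumed by `…SingBlowupOffFinset.hasResolution_of_rank_two_charts_off_finset` at the points of
  its finite exceptional set `S`.

Honest label: plumbing toward ONE leaf stub (no stub, crux or summit closed). No definitions, no named facts, no sorry.
[folklore; cite: Kollar2007, §2.2] [cite: GortzWedhorn2020, Prop. 13.91 (2)]
-/

noncomputable section

-- single-problem summit: the doubled namespace component is forced
set_option linter.dupNamespace false

open CategoryTheory AlgebraicGeometry TopologicalSpace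
open Literature.AlgebraicGeometry.Resolution
open Summit.ResolutionOfSingularities.ResolutionOfSingularities.Theorems.FRationalResolution

namespace Summit.ResolutionOfSingularities.ResolutionOfSingularities.Theorems.FRationalResolution.EtaleChartPrimaryCentreIsolated

open EtaleChartPrimaryCentre

/-- **`hloc` at ONE isolated singular point from an étale chart with trivial residue extension carrying a regular
`𝔪`-primary blow-up — local hypotheses only.** `X` integral, locally of finite type over a field; `x = φ y` a CLOSED
singular point, ISOLATED in the singular locus (`hiso`: an open `W₀ ∋ x` whose singular points are `x` alone);
`φ : Y → X` étale with every germ at `y` congruent modulo `𝔪_y` to a pulled-back germ; an affine open `V ∋ y` with an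
ideal `J`, `𝔮_yⁿ ⊆ J ⊆ 𝔮_y`, `Bl_J Spec Γ(Y, V)` regular. Then `x` has an open `W ∋ x` containing no other singular point
and a proper `ρ : Z → W`, `Z` regular, an isomorphism over `W ∩ Reg X` with dense preimage. Proof verbatim from
`…EtaleChartPrimaryCentre.hloc_of_etale_chart_primaryBlowup` with step (1) replaced by `hiso`.
[cite: Kollar2007, §2.2] [cite: GortzWedhorn2020, Prop. 13.91 (2)] -/
theorem hloc_of_etale_chart_primaryBlowup_of_isolated (k : Type) [Field k] (X : Scheme.{0}) [IsIntegral X]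
    (f : X ⟶ Spec (.of k)) [LocallyOfFiniteType f]
    {Y : Scheme.{0}} (φ : Y ⟶ X) [Etale φ] (y : Y) (hx : φ y ∉ Scheme.regularLocus X)
    (hxcl : IsClosed ({φ y} : Set X))
    (hiso : ∃ W₀ : X.Opens, φ y ∈ W₀ ∧ ∀ t : X, t ∉ Scheme.regularLocus X → t ∈ W₀ → t = φ y)
    (hres : ∀ c : Y.presheaf.stalk y, ∃ b : X.presheaf.stalk (φ y),
      c - (φ.stalkMap y).hom b ∈ IsLocalRing.maximalIdeal (Y.presheaf.stalk y))
    (hbl : ∃ (V : Y.Opens) (hV : IsAffineOpen V) (hyV : y ∈ V) (J : Ideal Γ(Y, V)) (n : ℕ),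
      (hV.primeIdealOf ⟨y, hyV⟩).asIdeal ^ n ≤ J ∧ J ≤ (hV.primeIdealOf ⟨y, hyV⟩).asIdeal ∧
        Scheme.IsRegular (affineBlowup J)) :
    ∃ (W : X.Opens), φ y ∈ W ∧ (∀ t : X, t ∉ Scheme.regularLocus X → t ∈ W → t = φ y) ∧
      ∃ (Z : Scheme.{0}) (ρ : Z ⟶ W), IsProper ρ ∧ Scheme.IsRegular Z ∧
        IsIso (ρ ∣_ (W.ι ⁻¹ᵁ ⟨Scheme.regularLocus X, isOpen_regularLocus_of_locallyOfFiniteType_field f⟩)) ∧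
        Dense ((ρ ⁻¹ᵁ (W.ι ⁻¹ᵁ ⟨Scheme.regularLocus X,
          isOpen_regularLocus_of_locallyOfFiniteType_field f⟩) : Z.Opens) : Set Z) := by
  classical
  obtain ⟨V, hV, hyV, J, n, hJn, hJQ, hregJ⟩ := hbl
  set x := φ y with hxdef
  -- (1) an open `W₀ ∋ x` containing no other singular point
  obtain ⟨W₀, hxW₀, hW₀⟩ := hiso
  -- (2) an affine open `U ∋ x` inside `W₀`
  obtain ⟨U, hU, hxU, hUW⟩ := exists_isAffineOpen_mem_and_subset (U := W₀) hxW₀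
  haveI : Nonempty U := ⟨⟨x, hxU⟩⟩
  set ι := hU.fromSpec with hιdef
  set 𝔭 := hU.primeIdealOf ⟨x, hxU⟩ with h𝔭def
  have hι𝔭 : ι 𝔭 = x := hU.fromSpec_primeIdealOf ⟨x, hxU⟩
  haveI h𝔭max : 𝔭.asIdeal.IsMaximal := hU.primeIdealOf_isMaximal_of_isClosed ⟨x, hxU⟩ hxcl
  -- points of `Spec Γ(X,U)` other than `𝔭` are regular
  have hregB : ∀ P : Spec Γ(X, U), P.asIdeal ≠ 𝔭.asIdeal → P ∈ Scheme.regularLocus (Spec Γ(X, U)) := by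
    intro P hP
    rw [mem_regularLocus_iff_of_flat_of_isPreimmersion ι]
    have hPU : ι P ∈ U := by
      have : ι P ∈ Set.range ι := ⟨P, rfl⟩
      rwa [hιdef, hU.range_fromSpec] at this
    have hPx : ι P ≠ x := by
      intro h
      apply hP
      have : P = 𝔭 := ι.isOpenEmbedding.injective (h.trans hι𝔭.symm)
      rw [this]
    by_contra hnreg
    exact hPx (hW₀ _ hnreg (hUW hPU))
  -- `𝔭 ≠ 0`: otherwise `Spec Γ(X,U) = {𝔭}` and the dense regular locus would contain `x`
  have h𝔭0 : 𝔭.asIdeal ≠ ⊥ := by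
    intro h0
    have hbot : (⊥ : Ideal Γ(X, U)).IsMaximal := h0 ▸ h𝔭max
    obtain ⟨t, htU, htreg⟩ := (Scheme.dense_regularLocus X).inter_open_nonempty U U.2 ⟨x, hxU⟩
    have htr : t ∈ Set.range ι := by rw [hιdef, hU.range_fromSpec]; exact htU
    obtain ⟨P, rfl⟩ := htr
    have hP : P.asIdeal = 𝔭.asIdeal := by
      rw [h0]
      exact (hbot.eq_of_le P.isPrime.ne_top bot_le).symm
    have hP' : P = 𝔭 := PrimeSpectrum.ext hP
    rw [hP', hι𝔭] at htreg
    exact hx htreg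
  -- (3) the `k`-algebra structure of `Γ(X,U)`
  obtain ⟨gk, hgk⟩ := Spec.map_surjective (ι ≫ f)
  letI : Algebra k Γ(X, U) := gk.hom.toAlgebra
  have hιf : ι ≫ f = Spec.map (CommRingCat.ofHom (algebraMap k Γ(X, U))) := by
    rw [← hgk]; rfl
  haveI : Algebra.FiniteType k Γ(X, U) := by
    have h1 : LocallyOfFiniteType (Spec.map gk) := by rw [hgk]; infer_instance
    rw [HasRingHomProperty.Spec_iff (P := @LocallyOfFiniteType)] at h1
    exact h1
  -- (4) the chart ring: a basic open `V' = D(g) ∋ y` of `V` inside `φ⁻¹ U`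
  have hyU : y ∈ φ ⁻¹ᵁ U := hxU
  obtain ⟨g, hgle, hyg⟩ := hV.exists_basicOpen_le (V := V ⊓ φ ⁻¹ᵁ U) ⟨y, ⟨hyV, hyU⟩⟩ hyV
  have hV' : IsAffineOpen (Y.basicOpen g) := hV.basicOpen g
  have hV'V : Y.basicOpen g ≤ V := Y.basicOpen_le g
  have e : Y.basicOpen g ≤ φ ⁻¹ᵁ U := fun z hz => (hgle hz).2
  set ψ := φ.appLE U (Y.basicOpen g) e with hψdef
  have hψ : ψ.hom.Etale := φ.etale_appLE hU hV' e
  letI : Algebra Γ(X, U) Γ(Y, Y.basicOpen g) := ψ.hom.toAlgebra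
  haveI : Algebra.Etale Γ(X, U) Γ(Y, Y.basicOpen g) := hψ
  set 𝔔 := hV.primeIdealOf ⟨y, hyV⟩ with h𝔔def
  set 𝔔' := hV'.primeIdealOf ⟨y, hyg⟩ with h𝔔'def
  have hcomap : 𝔔'.asIdeal.comap (algebraMap Γ(X, U) Γ(Y, Y.basicOpen g)) = 𝔭.asIdeal := by
    have h := hU.comap_primeIdealOf_appLE (f := φ) U (Y.basicOpen g) hV' e hyg
    exact congrArg PrimeSpectrum.asIdeal h
  haveI : 𝔔'.asIdeal.LiesOver 𝔭.asIdeal := ⟨hcomap.symm⟩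
  have hover : 𝔭.asIdeal ≤ 𝔔'.asIdeal.comap (algebraMap Γ(X, U) Γ(Y, Y.basicOpen g)) := hcomap.ge
  -- unramified at `𝔔'`
  have hunr : 𝔭.asIdeal.map (algebraMap Γ(X, U) (Localization.AtPrime 𝔔'.asIdeal)) =
      IsLocalRing.maximalIdeal (Localization.AtPrime 𝔔'.asIdeal) := by
    letI := Localization.AtPrime.algebraOfLiesOver 𝔭.asIdeal 𝔔'.asIdeal
    haveI : Algebra.IsUnramifiedAt Γ(X, U) 𝔔'.asIdeal :=
      (Algebra.formallyUnramified_iff_forall).mp inferInstance 𝔔'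
    exact ((Algebra.isUnramifiedAt_iff_map_eq Γ(X, U) 𝔭.asIdeal 𝔔'.asIdeal).mp inferInstance).2
  -- (5) the centre on the basic open: `J' = J Γ(Y, D(g))`, still `𝔔'`-primary with regular blow-up
  haveI hlocg : IsLocalization.Away g Γ(Y, Y.basicOpen g) := hV.isLocalization_basicOpen g
  have hQQ : 𝔔'.asIdeal.comap (algebraMap Γ(Y, V) Γ(Y, Y.basicOpen g)) = 𝔔.asIdeal := by
    ext s
    letI := Y.presheaf.algebra_section_stalk ⟨y, hyV⟩
    haveI := hV.isLocalization_stalk ⟨y, hyV⟩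
    letI := Y.presheaf.algebra_section_stalk (U := Y.basicOpen g) ⟨y, hyg⟩
    haveI := hV'.isLocalization_stalk ⟨y, hyg⟩
    rw [Ideal.mem_comap,
      ← IsLocalization.AtPrime.to_map_mem_maximal_iff (Y.presheaf.stalk y) 𝔔'.asIdeal,
      ← IsLocalization.AtPrime.to_map_mem_maximal_iff (Y.presheaf.stalk y) 𝔔.asIdeal]
    change (Y.presheaf.germ (Y.basicOpen g) y hyg).hom
        ((Y.presheaf.map (homOfLE (Y.basicOpen_le g)).op).hom s) ∈ _ ↔
      (Y.presheaf.germ V y hyV).hom s ∈ _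
    rw [TopCat.Presheaf.germ_res_apply]
  have hQ'eq : 𝔔'.asIdeal = 𝔔.asIdeal.map (algebraMap Γ(Y, V) Γ(Y, Y.basicOpen g)) := by
    rw [← hQQ]
    exact (IsLocalization.map_under (Submonoid.powers g) Γ(Y, Y.basicOpen g) 𝔔'.asIdeal).symm
  set J' : Ideal Γ(Y, Y.basicOpen g) := J.map (algebraMap Γ(Y, V) Γ(Y, Y.basicOpen g)) with hJ'def
  have hJ'Q : J' ≤ 𝔔'.asIdeal := by
    rw [hQ'eq]; exact Ideal.map_mono hJQ
  have hQ'J : 𝔔'.asIdeal ^ n ≤ J' := by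
    rw [hQ'eq, ← Ideal.map_pow]; exact Ideal.map_mono hJn
  have hregJ' : Scheme.IsRegular (affineBlowup J') := by
    haveI : IsOpenImmersion (Spec.map (CommRingCat.ofHom (algebraMap Γ(Y, V) Γ(Y, Y.basicOpen g)))) :=
      IsOpenImmersion.of_isLocalization g
    exact BlowupFlatCriteria.isRegular_affineBlowup_map_of_isOpenImmersion _ J hregJ
  -- (6) the residue condition read off the stalks
  have hres' : ∀ c : Γ(Y, Y.basicOpen g), ∃ b : Γ(X, U), c - algebraMap Γ(X, U) Γ(Y, Y.basicOpen g) b ∈ 𝔔'.asIdeal := by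
    intro c
    letI := X.presheaf.algebra_section_stalk ⟨x, hxU⟩
    haveI := hU.isLocalization_stalk ⟨x, hxU⟩
    letI := Y.presheaf.algebra_section_stalk (U := Y.basicOpen g) ⟨y, hyg⟩
    haveI := hV'.isLocalization_stalk ⟨y, hyg⟩
    obtain ⟨bx, hbx⟩ := hres ((Y.presheaf.germ (Y.basicOpen g) y hyg).hom c)
    obtain ⟨⟨b, s⟩, hbs⟩ := IsLocalization.surj 𝔭.asIdeal.primeCompl bx
    obtain ⟨s', i, hi, hs'⟩ := h𝔭max.exists_inv (show (s : Γ(X, U)) ∉ 𝔭.asIdeal from s.2)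
    refine ⟨b * s', ?_⟩
    rw [← IsLocalization.AtPrime.to_map_mem_maximal_iff (Y.presheaf.stalk y) 𝔔'.asIdeal, map_sub]
    change (Y.presheaf.germ (Y.basicOpen g) y hyg).hom c -
        (Y.presheaf.germ (Y.basicOpen g) y hyg).hom (ψ.hom (b * s')) ∈ _
    rw [hψdef, germ_appLE_apply φ U (Y.basicOpen g) e y hyg]
    -- `b_x − (b s')_x = b_x · i_x ∈ 𝔪_x`
    have hgerm : (X.presheaf.germ U (φ y) (e hyg)).hom (b * s') = bx - bx * algebraMap Γ(X, U) _ i := by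
      have h1 : algebraMap Γ(X, U) (X.presheaf.stalk x) (b * s') =
          bx * algebraMap Γ(X, U) _ ((s : Γ(X, U)) * s') := by
        rw [map_mul, map_mul, ← hbs, mul_assoc]
      have h2 : (s : Γ(X, U)) * s' = 1 - i := by
        rw [← hs']; ring
      change algebraMap Γ(X, U) (X.presheaf.stalk x) (b * s') = _
      rw [h1, h2, map_sub, map_one]; ring
    rw [hgerm, map_sub, map_mul]
    have hi' : algebraMap Γ(X, U) (X.presheaf.stalk x) i ∈ IsLocalRing.maximalIdeal _ :=
      (IsLocalization.AtPrime.to_map_mem_maximal_iff (X.presheaf.stalk x) 𝔭.asIdeal i).mpr hi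
    have hmem : (φ.stalkMap y).hom bx * (φ.stalkMap y).hom (algebraMap Γ(X, U) (X.presheaf.stalk x) i) ∈
        IsLocalRing.maximalIdeal (Y.presheaf.stalk y) := by
      refine Ideal.mul_mem_left _ _ ?_
      rw [IsLocalRing.mem_maximalIdeal] at hi' ⊢
      exact fun hu => hi' ((isUnit_map_iff (φ.stalkMap y).hom _).mp hu)
    have := Ideal.add_mem _ hbx hmem
    convert this using 1
    ring
  -- `𝔔'` is maximal: `Γ(Y, D(g)) / 𝔔' ≅ Γ(X, U) / 𝔭` is a field
  haveI h𝔔'max : 𝔔'.asIdeal.IsMaximal := by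
    let q : Γ(X, U) →+* Γ(Y, Y.basicOpen g) ⧸ 𝔔'.asIdeal :=
      (Ideal.Quotient.mk 𝔔'.asIdeal).comp (algebraMap Γ(X, U) Γ(Y, Y.basicOpen g))
    have hq : Function.Surjective q := by
      intro c
      obtain ⟨c, rfl⟩ := Ideal.Quotient.mk_surjective c
      obtain ⟨b, hb⟩ := hres' c
      refine ⟨b, ?_⟩
      change Ideal.Quotient.mk 𝔔'.asIdeal (algebraMap Γ(X, U) Γ(Y, Y.basicOpen g) b) = _
      rw [Ideal.Quotient.eq]
      have := 𝔔'.asIdeal.neg_mem hb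
      convert this using 1
      ring
    have hker : RingHom.ker q = 𝔭.asIdeal := by
      rw [← hcomap, RingHom.ker, ← Ideal.comap_comap, ← RingHom.ker, Ideal.mk_ker]
    have hF : IsField (Γ(X, U) ⧸ RingHom.ker q) := by
      have : (RingHom.ker q).IsMaximal := hker ▸ h𝔭max
      exact (Ideal.Quotient.maximal_ideal_iff_isField_quotient _).mp this
    exact Ideal.Quotient.maximal_of_isField _
      (MulEquiv.isField hF (RingHom.quotientKerEquivOfSurjective hq).symm.toMulEquiv)
  -- (7) transfer
  have hsing : ι ⟨𝔭.asIdeal, h𝔭max.isPrime⟩ ∉ Scheme.regularLocus X := by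
    change ι 𝔭 ∉ _
    rw [hι𝔭]; exact hx
  obtain ⟨W, hxW, huniq, Z, ρ, hρ, hZ, hiso, hdense⟩ :=
    PrimaryCentreEtale.hloc_of_primaryBlowup_flat_chart k X f ι hιf 𝔭.asIdeal h𝔭0 hsing hregB 𝔔'.asIdeal
      hover hres' hunr J' hQ'J hJ'Q hregJ'
  have hpt : ι ⟨𝔭.asIdeal, h𝔭max.isPrime⟩ = x := hι𝔭
  rw [hpt] at hxW huniq
  exact ⟨W, hxW, huniq, Z, ρ, hρ, hZ, hiso, hdense⟩

end Summit.ResolutionOfSingularities.ResolutionOfSingularities.Theorems.FRationalResolution.EtaleChartPrimaryCentreIsolated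

end
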